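import Literature.Barriers.RiemannHypothesis.EpsteinZetaRealZerosDHOdd
import Literature.Barriers.RiemannHypothesis.EpsteinZetaRealZerosDHForms
import HarnessLib

/-!
# Davenport–Heilbronn for Epstein zeta functions, XV: the discharge of
# `DavenportHeilbronn1936b_epstein`

Sibling of `Literature/Barriers/RiemannHypothesis/EpsteinZetaRealZeros.lean`, proving its named fact
`DavenportHeilbronn1936b_epstein` (Davenport–Heilbronn 1936 I–II; Titchmarsh §10.27; Stark §1):
for integers `a, b, c` with `Q = (a, b, c)` positive definite, `d = b² − 4ac` a fundamental
discriminant and two inequivalent form classes (`h(d) > 1`), `ζ_Q(s)` has infinitely many zeros in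
`σ > 1`, and at least `C·T` of them with `0 < ℑs ≤ T` for all large `T`.

Proof: pass to the imaginary quadratic field `K = ℚ(√d)` and the lattice ideal of the form
(`exists_fieldData`, `EpsteinZetaRealZerosDHForms.lean`: `d = d_K = t² + 4m < −4`,
`Q ∼ (a, −b, c) = (A, t − 2k, C)`, `2 ≤ h_K`), and split on the parity of `h_K`:
`h_K` even — Davenport–Heilbronn I, Theorem 3 (`davenportHeilbronn_conclusion_of_even_card`: a real
class-group character and the genus twist `a(p) ∈ {1, i}`); `h_K` odd — Davenport–Heilbronn II,
Theorem (`davenportHeilbronn_conclusion_of_odd_card`: the steered unimodular twist of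
`EpsteinZetaRealZerosDHOdd.lean`). In both cases the analytic half is
`davenportHeilbronn_conclusion_of_twist_zero` (`EpsteinZetaRealZerosDHShifts.lean`: Bohr's
equivalence/Kronecker–Weyl, Rouché, and the Montgomery–Vaughan continuation for the count), which
supplies Titchmarsh's "number of such zeros up to height `T` is at least of order `T`".

## References

* [DavenportHeilbronn1936a] H. Davenport, H. Heilbronn, *On the zeros of certain Dirichlet
  series I*, J. London Math. Soc. 11 (1936), 181–185, Theorem 3.
* [DavenportHeilbronn1936b] — *II*, ibid. 307–312, Theorem.
* [Titchmarsh1986] E. C. Titchmarsh, *The Theory of the Riemann Zeta-Function*, 2nd ed., §10.25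
  and §10.27.
-/

noncomputable section

open Filter Topology Complex NumberField Module
open Literature.NumberTheory.QuadraticFields.Quadratic

namespace Literature.Barriers.RiemannHypothesis

open DHEpstein

/-- **Davenport–Heilbronn 1936 (I, Theorem 3 and II, Theorem), with Titchmarsh's `≫ T` count —
the discharge of the named fact `DavenportHeilbronn1936b_epstein`.** If `a, b, c` are integers,
`Q = (a, b, c)` is positive definite, `d = b² − 4ac` is a fundamental discriminant and there are two
properly inequivalent positive definite forms of discriminant `d` (`h(d) > 1`), then `ζ_Q(s)` has
infinitely many zeros with `σ > 1`, and the number of them with `0 < ℑs ≤ T` is `≥ C·T` for all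
large `T`. [cite: DavenportHeilbronn1936a, §4 Theorem 3] [cite: DavenportHeilbronn1936b, §6 Theorem]
[cite: Titchmarsh1986, §10.27] -/
theorem DavenportHeilbronn1936b_epstein_holds : DavenportHeilbronn1936b_epstein := by
  intro a b c hQ hd h2f
  obtain ⟨K, _, _, bK, t, m, k, h2, hb, hω, hD, ha, hn, htk, h2le, -⟩ := exists_fieldData a b c hQ hd h2f
  rcases Nat.even_or_odd (Nat.card (ClassGroup (𝓞 K))) with heven | hodd
  · have H := davenportHeilbronn_conclusion_of_even_card h2 bK hb hω hD ha hn heven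
    simp only [epsteinZeta_intCast_sub_two_mul htk] at H
    exact H
  · have H := davenportHeilbronn_conclusion_of_odd_card h2 bK hb hω hD ha hn hodd (by omega)
    simp only [epsteinZeta_intCast_sub_two_mul htk] at H
    exact H

end Literature.Barriers.RiemannHypothesis
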